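import Summits.ResolutionOfSingularities.ResolutionOfSingularities.Theorems.JetCutJetKernels3
import HarnessLib

/-!
# JetCutJetKernels4 — decomp-res node «JetCut» (lens-2 g15 rev 5), file 4/4 of `JetCutJetKernels`

Content VERBATIM from the decomp-res lens-2 file `HOME/decomp-res-lens-2/g15/JetCut.lean` rev 5 (pin 9f53e5ca =
`parts/JetCut-rev5-9f53e5ca.lean`, 7 495 l;
HOME = run/shared/lean/pub/decomp-res; CRITIC-LEDGER rows 109 / 115 / 120 / 121 / 122 / 127 / 133 CLEARED; landing
order INBOX :231; the critic's
HYGIENE-landing.md h1–h11 applied — DOCSTRING-ONLY).  The lens's blocks RESTATED VERBATIM from lens-2 g12 / g13 /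
g14 (§R / §R13 / §R14) are DELETED:
they are the tree's `RelativeDeltaCut*` / `CurveLeafExit*` / `PinchCut*` modules (namespaces `RelativeDeltaCut`,
`CurveLeafExit`, `PinchCut`, opened;
the lens's `CurveLeafExitRestated.x` / `PinchCutRestated.x` are cited as `CurveLeafExit.x` / `PinchCut.x`, the three
pointwise engine edges of g12 as
`RelativeDeltaCut.x`).  Namespace `…Theorems.JetCut` (the lens's `Theses.JetCut` is gate-reserved), sub-namespaces
`Tame` / `Wide` / `Broad` / `Vast`
as in the lens; file split only (tree files ≤ 400 lines): sections, variables and every declaration exactly as in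
the lens, the long rev-0/1 prose
lives in HOME/decomp-res-lens-2/g15/NODE-g15.md §ARCHIVE-A (not in the tree).  Node files, in import order:
`JetCutJetKernels`, `JetCutPoint`, `JetCutClasses`, `JetCutKernels`, `JetCutTame`, `JetCutTameClasses`,
`JetCutTameKernels`, `JetCutLadder`, `JetCutWideClasses`, `JetCutWideKernels`, `JetCutMixed`, `JetCutBroadClasses`,
`JetCutBroadKernels`, `JetCutDegenerate`, `JetCutVastClasses`, `JetCutVastKernels`
(each possibly continued `…2`, `…3`), then the wiring `MaxContactCutJetCut*` (in the Theses cone).  All `--supports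
stmt-ResolutionOfSingularities-29273`
(`MaxContactCut.RungOne`); nothing closes 29273 — decided cells carry their engines as hypotheses, and exactly ONE
located-residual aside is booked on
the route for this column (`Vast.VastSpecialRung`, home `JetCutVastClasses`).

§J1 + §J1b: RING LEVEL of the jet test — the chart relations `chartRel` of the blow-up algebra of a regular
sequence, the ONE-STEP test `JetShallow`, and its KERNELS over an arbitrary commutative ring: representability of
`(c)^{m+1}` by forms, **`jetShallow_of_coneShallow`** ((C) ⊆ (J), PROVED), `not_jetShallow_zero` (quantifier-shape
sanity), the typed (CT) test `ConeTailShallow`, the regularity port `ExcParamRegular`,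
**`jetShallow_of_coneTailShallow`** ((CT) ⊆ (J) modulo the port, PROVED).

Part 4/4 carries: `jetShallow_of_coneTailShallow`.

(Sources: HunekeSwanson2006 Cor. 5.5.5; CossartJannsenSaito2020 Ch. 2, Thm. 3.6/3.7, Ch. 8; CossartPiltant2008 Prop.
4.2; CossartPiltant2019 Rem. 3.2; Hironaka1964 Ch. III; Hironaka1967; Hironaka1977; Moh1987; Giraud1975.)
-/

open CategoryTheory AlgebraicGeometry TopologicalSpace IsLocalRing
open Literature.AlgebraicGeometry.Resolution
open Summit.ResolutionOfSingularities.ResolutionOfSingularities.Theorems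
open Summit.ResolutionOfSingularities.ResolutionOfSingularities.Theorems.WeakOrderReduction
open Summit.ResolutionOfSingularities.ResolutionOfSingularities.Theorems.DeltaFaceCutClasses
open Summit.ResolutionOfSingularities.ResolutionOfSingularities.Theorems.RelativeDeltaCut
open Summit.ResolutionOfSingularities.ResolutionOfSingularities.Theorems.CurveLeafExit
open Summit.ResolutionOfSingularities.ResolutionOfSingularities.Theorems.PinchCut

namespace Summit.ResolutionOfSingularities.ResolutionOfSingularities.Theorems.JetCut

section JetKernels

variable {R : Type} [CommRing R] {d : ℕ}

/-- [rev 1] **(CT) ⊆ (J) at ring level, PROVED modulo the typed regularity port** (critic cn21 (1)/(5): «(CT) PROVED sound,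
kernel preferred»): a normalised slope-one presentation `c₀ⁿ + v·Ψ(c') + Γ(c') + c₀·h + g ∈ J` (`Ψ`, `γ_i` degree-`n`
forms, `Γ = Σ U_i γ_i` the first tail layer, `h ∈ (c)ⁿ` the `z`-slack, `g ∈ (c)ⁿ⁺²`) that passes the cone-tail test is
JET-SHALLOW at every marking `n ≥ 2`, over an ARBITRARY commutative ring, given `ExcParamRegular (c, v)`.  Proof: witness
`F := X₀ⁿ + v·Ψ̃ + Σ_i c_{i+1}·γ̃_i + X₀·H + G` (`H`, `G` forms representing `h`, `g` with coefficients in `(c)`, `(c)²`);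
charts `j = 0` / `X₀ ∉ 𝔐` as in `jetShallow_of_coneShallow`; at `𝔐 ∋ X₀`, cone branch by the residue transport `ψ`,
tail branch: `dehomog_j F ∈ chartRel + 𝔐ⁿ ⊆ 𝔄 := chartRel + 𝔐² + (X₀) + (v)` isolates `dehomog_j(Σ c_{i+1}γ̃_i) ∈ 𝔄`,
and `dehomog_j(Σ c_{i+1}γ̃_i) ≡ c_j·dehomog_j Γ̃ (mod chartRel)` (the generators `c_{i+1} − c_j·X_{i+1}`), so the port
gives `dehomog_j Γ̃ ∈ 𝔐`, i.e. `Γ̄_i ∈ 𝔑` after transport — contradicting the tail branch.  (`n ≥ 2` is necessary: at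
`n = 1` a unit tail coefficient does not lower the order below `1`.) [folklore] -/
theorem jetShallow_of_coneTailShallow {n : ℕ} (hn : 2 ≤ n) (c : Fin (d + 1) → R) (v h g : R)
    (Ψ : MvPolynomial (Fin d) R) (γ : Fin d → MvPolynomial (Fin d) R) (J : Ideal R)
    (hΨdeg : ∀ m ∈ Ψ.support, Finsupp.degree m = n)
    (hγdeg : ∀ i, ∀ m ∈ (γ i).support, Finsupp.degree m = n)
    (hh : h ∈ Ideal.span (Set.range c) ^ n) (hg : g ∈ Ideal.span (Set.range c) ^ (n + 2))
    (hf : c 0 ^ n + v * MvPolynomial.eval (fun i : Fin d => c i.succ) Ψ +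
        MvPolynomial.eval (fun i : Fin d => c i.succ) (∑ i, MvPolynomial.X i * γ i) + c 0 * h + g ∈ J)
    (hCT : ConeTailShallow (Ideal.span (Set.range c)) v Ψ γ n)
    (hreg : ExcParamRegular (Ideal.span (Set.range c ∪ {v})) c v) :
    JetShallow (Ideal.span (Set.range c ∪ {v})) c J n := by
  classical
  obtain ⟨m, rfl⟩ : ∃ m, n = m + 2 := ⟨n - 2, by omega⟩
  set P : Ideal R := Ideal.span (Set.range c) with hP
  set M : Ideal R := Ideal.span (Set.range c ∪ {v}) with hM
  have hPM : P ≤ M := Ideal.span_mono Set.subset_union_left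
  have hcP : ∀ i, c i ∈ P := fun i => Ideal.subset_span ⟨i, rfl⟩
  have hcM : ∀ i, c i ∈ M := fun i => hPM (hcP i)
  have hvM : v ∈ M := Ideal.subset_span (Or.inr rfl)
  -- the slack forms
  have hh' : h ∈ P * P ^ (m + 1) := by rw [← pow_succ']; exact hh
  obtain ⟨H, hHh, hHc, hHe⟩ := exists_form_of_mem_mul_span_pow c P (m + 1) hh'
  have hg' : g ∈ P ^ 2 * P ^ (m + 2) := by
    rw [← pow_add, show 2 + (m + 2) = m + 2 + 2 by ring]; exact hg
  obtain ⟨G, hGh, hGc, hGe⟩ := exists_form_of_mem_mul_span_pow c (P ^ 2) (m + 2) hg'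
  have hΨh : Ψ.IsHomogeneous (m + 2) := by
    intro β hβ
    have hβ' : β ∈ Ψ.support := MvPolynomial.mem_support_iff.2 hβ
    have e := hΨdeg β hβ'
    rw [Finsupp.degree_eq_weight_one] at e
    exact e
  have hγh : ∀ i, (γ i).IsHomogeneous (m + 2) := by
    intro i β hβ
    have hβ' : β ∈ (γ i).support := MvPolynomial.mem_support_iff.2 hβ
    have e := hγdeg i β hβ'
    rw [Finsupp.degree_eq_weight_one] at e
    exact e
  set Ψt : MvPolynomial (Fin (d + 1)) R := MvPolynomial.rename Fin.succ Ψ with hΨt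
  set Γ : MvPolynomial (Fin d) R := ∑ i, MvPolynomial.X i * γ i with hΓ
  set Γ₂ : MvPolynomial (Fin (d + 1)) R :=
    ∑ i : Fin d, MvPolynomial.C (c i.succ) * MvPolynomial.rename Fin.succ (γ i) with hΓ₂
  set F : MvPolynomial (Fin (d + 1)) R :=
    MvPolynomial.X 0 ^ (m + 2) + MvPolynomial.C v * Ψt + Γ₂ + MvPolynomial.X 0 * H + G with hF
  intro j Q hQ hMQ hXj
  have hCQ : ∀ r ∈ M, (MvPolynomial.C r : MvPolynomial (Fin (d + 1)) R) ∈ Q :=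
    fun r hr => hMQ (Ideal.mem_map_of_mem _ hr)
  have hrel : chartRel c j ≤ Q := by
    rw [chartRel, Ideal.span_le]
    rintro _ ⟨i, rfl⟩
    exact Q.sub_mem (hCQ _ (hcM i)) (Q.mul_mem_right _ (hCQ _ (hcM j)))
  have hsub : chartRel c j ⊔ Q ^ (m + 2) ≤ Q := sup_le hrel (Ideal.pow_le_self (by omega))
  have halg : ∀ b ∈ M, algebraMap R (MvPolynomial (Fin (d + 1)) R) b ∈ Q := by
    intro b hb
    rw [MvPolynomial.algebraMap_eq]
    exact hCQ b hb
  -- the pieces of `dehomog j F`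
  have hsplit : dehomog j F = dehomog j (MvPolynomial.X 0 ^ (m + 2)) + MvPolynomial.C v * dehomog j Ψt +
      dehomog j Γ₂ + dehomog j (MvPolynomial.X 0) * dehomog j H + dehomog j G := by
    simp only [hF, dehomog, map_add, map_mul, MvPolynomial.aeval_C, MvPolynomial.algebraMap_eq]
  have hsplitΓ : dehomog j Γ₂ =
      ∑ i : Fin d, MvPolynomial.C (c i.succ) * dehomog j (MvPolynomial.rename Fin.succ (γ i)) := by
    simp only [hΓ₂, dehomog, map_sum, map_mul, MvPolynomial.aeval_C, MvPolynomial.algebraMap_eq]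
  have hΨtQ : MvPolynomial.C v * dehomog j Ψt ∈ Q := Q.mul_mem_right _ (hCQ v hvM)
  have hΓ₂Q : dehomog j Γ₂ ∈ Q := by
    rw [hsplitΓ]
    exact Ideal.sum_mem _ fun i _ => Q.mul_mem_right _ (hCQ _ (hcM i.succ))
  have hHQ : dehomog j H ∈ Q :=
    algHom_apply_mem_of_coeff_mem _ P Q (fun b hb => halg b (hPM hb)) H hHc
  have hXHQ : dehomog j (MvPolynomial.X 0) * dehomog j H ∈ Q := Q.mul_mem_left _ hHQ
  have hP2M : P ^ 2 ≤ M := (Ideal.pow_le_self two_ne_zero).trans hPM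
  have hGQ : dehomog j G ∈ Q :=
    algHom_apply_mem_of_coeff_mem _ (P ^ 2) Q (fun b hb => halg b (hP2M hb)) G hGc
  refine ⟨F, ?_, ?_, ?_⟩
  · -- homogeneous of degree `m + 2`
    have h1 : (MvPolynomial.X (0 : Fin (d + 1)) ^ (m + 2) : MvPolynomial (Fin (d + 1)) R).IsHomogeneous (m + 2) :=
      MvPolynomial.isHomogeneous_X_pow _ _
    have h2 : (MvPolynomial.C v * Ψt).IsHomogeneous (m + 2) := by
      simpa using (MvPolynomial.isHomogeneous_C _ v).mul hΨh.rename_isHomogeneous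
    have h3 : Γ₂.IsHomogeneous (m + 2) := by
      refine MvPolynomial.IsHomogeneous.sum _ _ _ ?_
      intro i _
      simpa using (MvPolynomial.isHomogeneous_C _ (c i.succ)).mul (hγh i).rename_isHomogeneous
    have h4 : (MvPolynomial.X (0 : Fin (d + 1)) * H).IsHomogeneous (m + 2) := by
      have e := (MvPolynomial.isHomogeneous_X R (0 : Fin (d + 1))).mul hHh
      rw [show 1 + (m + 1) = m + 2 by ring] at e
      exact e
    exact (((h1.add h2).add h3).add h4).add hGh
  · -- value at `c`
    have e : MvPolynomial.eval c F = c 0 ^ (m + 2) + v * MvPolynomial.eval (fun i : Fin d => c i.succ) Ψ +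
        MvPolynomial.eval (fun i : Fin d => c i.succ) (∑ i, MvPolynomial.X i * γ i) + c 0 * h + g := by
      simp [hF, hΨt, hΓ₂, MvPolynomial.eval_rename, hHe, hGe, Function.comp_def]
    rw [e]
    exact hf
  · -- non-membership
    intro hmem
    have hFQ : dehomog j F ∈ Q := hsub hmem
    by_cases hj0 : j = 0
    · subst hj0
      have e1 : dehomog (0 : Fin (d + 1)) (MvPolynomial.X 0 ^ (m + 2) : MvPolynomial (Fin (d + 1)) R) = 1 := by
        simp [dehomog]
      have e2 : dehomog (0 : Fin (d + 1)) (MvPolynomial.X 0 : MvPolynomial (Fin (d + 1)) R) = 1 := by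
        simp [dehomog]
      have : (1 : MvPolynomial (Fin (d + 1)) R) ∈ Q := by
        have e3 : dehomog 0 F = 1 + (MvPolynomial.C v * dehomog 0 Ψt + dehomog 0 Γ₂ + dehomog 0 H +
            dehomog 0 G) := by
          rw [hsplit, e1, e2]; ring
        rw [e3] at hFQ
        have h' := Q.sub_mem hFQ (Q.add_mem (Q.add_mem (Q.add_mem hΨtQ hΓ₂Q) hHQ) hGQ)
        rwa [add_sub_cancel_right] at h'
      exact hQ.ne_top ((Ideal.eq_top_iff_one _).2 this)
    · obtain ⟨i, rfl⟩ := Fin.exists_succ_eq.2 hj0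
      have hdX : dehomog (Fin.succ i) (MvPolynomial.X 0 ^ (m + 2) : MvPolynomial (Fin (d + 1)) R) =
          MvPolynomial.X 0 ^ (m + 2) := by
        simp [dehomog, (Fin.succ_ne_zero i).symm]
      have hdX1 : dehomog (Fin.succ i) (MvPolynomial.X 0 : MvPolynomial (Fin (d + 1)) R) = MvPolynomial.X 0 := by
        simp [dehomog, (Fin.succ_ne_zero i).symm]
      by_cases hX0 : (MvPolynomial.X 0 : MvPolynomial (Fin (d + 1)) R) ∈ Q
      · -- residue transport to `(R ⧸ P)[U]`
        haveI : Q.IsMaximal := hQ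
        letI : Field (MvPolynomial (Fin (d + 1)) R ⧸ Q) := Ideal.Quotient.field Q
        set mkQ := Ideal.Quotient.mk Q with hmkQ
        set ψ : MvPolynomial (Fin (d + 1)) R →ₐ[R] MvPolynomial (Fin d) (R ⧸ P) :=
          MvPolynomial.aeval (Fin.cases (0 : MvPolynomial (Fin d) (R ⧸ P)) fun k => MvPolynomial.X k) with hψ
        have hψC : ∀ a : R, ψ (MvPolynomial.C a) = MvPolynomial.C (Ideal.Quotient.mk P a) := by
          intro a
          simp [hψ, MvPolynomial.algebraMap_apply]
        have hψX0 : ψ (MvPolynomial.X 0) = 0 := by simp [hψ]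
        have hψXs : ∀ k : Fin d, ψ (MvPolynomial.X k.succ) = MvPolynomial.X k := by
          intro k; simp [hψ]
        have hker : ∀ a ∈ P, (mkQ.comp MvPolynomial.C) a = 0 := by
          intro a ha
          simp only [RingHom.comp_apply, hmkQ, Ideal.Quotient.eq_zero_iff_mem]
          exact hCQ a (hPM ha)
        set χ : MvPolynomial (Fin d) (R ⧸ P) →+* MvPolynomial (Fin (d + 1)) R ⧸ Q :=
          MvPolynomial.eval₂Hom (Ideal.Quotient.lift P (mkQ.comp MvPolynomial.C) hker)
            (fun k => mkQ (MvPolynomial.X k.succ)) with hχ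
        have hχψ : ∀ q, χ (ψ q) = mkQ q := by
          intro q
          induction q using MvPolynomial.induction_on with
          | C a => simp [hψC, hχ]
          | add p q hp hq => simp [map_add, hp, hq]
          | mul_X p k hp =>
            rw [map_mul, map_mul, hp, map_mul]
            congr 1
            refine Fin.cases ?_ (fun k' => ?_) k
            · rw [hψX0, map_zero]
              exact ((Ideal.Quotient.eq_zero_iff_mem).2 hX0).symm
            · rw [hψXs]; simp [hχ]
        have hχsurj : Function.Surjective χ := by
          have : Function.Surjective (χ ∘ ψ) := by
            intro x
            obtain ⟨q, rfl⟩ := Ideal.Quotient.mk_surjective x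
            exact ⟨q, hχψ q⟩
          exact this.of_comp
        set N : Ideal (MvPolynomial (Fin d) (R ⧸ P)) := RingHom.ker χ with hN
        have hNmax : N.IsMaximal := RingHom.ker_isMaximal_of_surjective χ hχsurj
        have hmemN : ∀ q, ψ q ∈ N ↔ q ∈ Q := by
          intro q
          rw [hN, RingHom.mem_ker, hχψ]
          exact Ideal.Quotient.eq_zero_iff_mem
        have hvN : MvPolynomial.C (Ideal.Quotient.mk P v) ∈ N := by
          rw [← hψC, hmemN]; exact hCQ v hvM
        have hXN : (MvPolynomial.X i : MvPolynomial (Fin d) (R ⧸ P)) ∈ N := by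
          rw [← hψXs, hmemN]; exact hXj
        have key : ∀ H' : MvPolynomial (Fin d) R,
            ψ (dehomog i.succ (MvPolynomial.rename Fin.succ H')) =
              dehomog i (MvPolynomial.map (Ideal.Quotient.mk P) H') := by
          intro H'
          induction H' using MvPolynomial.induction_on with
          | C a => simp [dehomog, hψC]
          | add p q hp hq => simp only [dehomog] at hp hq ⊢; simp only [map_add, hp, hq]
          | mul_X p k hp =>
            simp only [dehomog] at hp ⊢
            simp only [map_mul, MvPolynomial.rename_X, MvPolynomial.aeval_X, MvPolynomial.map_X, hp]
            congr 1
            by_cases hk : k = i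
            · subst hk; simp
            · have : (Fin.succ k) ≠ Fin.succ i := fun e => hk (Fin.succ_inj.1 e)
              simp [hk, this, hψXs]
        rcases hCT i N hNmax hvN hXN with hcone | htail
        · -- cone branch: transport the membership to `N ^ (m+2)`
          apply hcone
          have hψQ : Ideal.map (ψ : MvPolynomial (Fin (d + 1)) R →+* MvPolynomial (Fin d) (R ⧸ P)) Q ≤ N := by
            rw [Ideal.map_le_iff_le_comap]
            intro q hq
            rw [Ideal.mem_comap]
            exact (hmemN q).2 hq
          have hψrel : Ideal.map (ψ : MvPolynomial (Fin (d + 1)) R →+* MvPolynomial (Fin d) (R ⧸ P))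
              (chartRel c i.succ) = ⊥ := by
            rw [chartRel, Ideal.map_span, Ideal.span_eq_bot]
            rintro _ ⟨_, ⟨k, rfl⟩, rfl⟩
            have e1 : ψ (MvPolynomial.C (c k)) = 0 := by
              rw [hψC, (Ideal.Quotient.eq_zero_iff_mem).2 (hcP k), MvPolynomial.C_0]
            have e2 : ψ (MvPolynomial.C (c i.succ)) = 0 := by
              rw [hψC, (Ideal.Quotient.eq_zero_iff_mem).2 (hcP i.succ), MvPolynomial.C_0]
            simp [map_sub, map_mul, e1, e2]
          have hmem' : ψ (dehomog i.succ F) ∈ N ^ (m + 2) := by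
            have e := Ideal.mem_map_of_mem (ψ : MvPolynomial (Fin (d + 1)) R →+* MvPolynomial (Fin d) (R ⧸ P)) hmem
            rw [Ideal.map_sup, hψrel, bot_sup_eq, Ideal.map_pow] at e
            exact Ideal.pow_right_mono hψQ (m + 2) e
          have hΓN : ψ (dehomog i.succ Γ₂) = 0 := by
            rw [hsplitΓ, map_sum]
            refine Finset.sum_eq_zero ?_
            intro k _
            rw [map_mul, hψC, (Ideal.Quotient.eq_zero_iff_mem).2 (hcP k.succ), MvPolynomial.C_0, zero_mul]
          have hGN : ψ (dehomog i.succ G) ∈ N ^ (m + 2) := by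
            have e := algHom_apply_mem_of_coeff_mem
              (ψ.comp (MvPolynomial.aeval fun i' : Fin (d + 1) =>
                if i' = i.succ then (1 : MvPolynomial (Fin (d + 1)) R) else MvPolynomial.X i'))
              (P ^ 2) (N ^ (m + 2)) ?_ G hGc
            · simpa [dehomog] using e
            · intro b hb
              rw [MvPolynomial.algebraMap_apply, Ideal.Quotient.algebraMap_eq,
                (Ideal.Quotient.eq_zero_iff_mem).2 (Ideal.pow_le_self two_ne_zero hb), MvPolynomial.C_0]
              exact Ideal.zero_mem _
          have e3 : ψ (dehomog i.succ F) = ψ (MvPolynomial.C v * dehomog i.succ Ψt) +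
              (ψ (dehomog i.succ Γ₂) + ψ (MvPolynomial.X 0) * ψ (dehomog i.succ H) + ψ (dehomog i.succ G)) := by
            rw [hsplit, hdX, hdX1]
            simp only [map_add, map_mul, map_pow, hψX0]
            rw [zero_pow (by omega : m + 2 ≠ 0)]
            ring
          have hrest : ψ (dehomog i.succ Γ₂) + ψ (MvPolynomial.X 0) * ψ (dehomog i.succ H) +
              ψ (dehomog i.succ G) ∈ N ^ (m + 2) := by
            refine Ideal.add_mem _ (Ideal.add_mem _ ?_ ?_) hGN
            · rw [hΓN]; exact Ideal.zero_mem _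
            · rw [hψX0, zero_mul]; exact Ideal.zero_mem _
          have hΨN : ψ (MvPolynomial.C v * dehomog i.succ Ψt) ∈ N ^ (m + 2) := by
            rw [e3] at hmem'
            have e := (N ^ (m + 2)).sub_mem hmem' hrest
            rwa [add_sub_cancel_right] at e
          have e4 : dehomog i (MvPolynomial.map (Ideal.Quotient.mk P) (MvPolynomial.C v * Ψ)) =
              MvPolynomial.C (Ideal.Quotient.mk P v) * dehomog i (MvPolynomial.map (Ideal.Quotient.mk P) Ψ) := by
            simp [dehomog, map_mul]
          rw [e4]
          rw [map_mul, hψC, hΨt, key] at hΨN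
          exact hΨN
        · -- tail branch: isolate `u_j · Γ_j` modulo `chartRel + Q² + (X₀) + (v)` and use the regularity port
          apply htail
          set A : Ideal (MvPolynomial (Fin (d + 1)) R) :=
            chartRel c i.succ ⊔ Q ^ 2 ⊔ Ideal.span {(MvPolynomial.X 0 : MvPolynomial (Fin (d + 1)) R)} ⊔
              Ideal.span {(MvPolynomial.C v : MvPolynomial (Fin (d + 1)) R)} with hA
          have hA1 : chartRel c i.succ ≤ A := le_sup_left.trans (le_sup_left.trans le_sup_left)
          have hA2 : Q ^ 2 ≤ A := le_sup_right.trans (le_sup_left.trans le_sup_left)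
          have hA3 : (MvPolynomial.X 0 : MvPolynomial (Fin (d + 1)) R) ∈ A := by
            have e : Ideal.span {(MvPolynomial.X 0 : MvPolynomial (Fin (d + 1)) R)} ≤ A :=
              le_sup_right.trans le_sup_left
            exact e (Ideal.mem_span_singleton_self _)
          have hA4 : (MvPolynomial.C v : MvPolynomial (Fin (d + 1)) R) ∈ A := by
            have e : Ideal.span {(MvPolynomial.C v : MvPolynomial (Fin (d + 1)) R)} ≤ A := le_sup_right
            exact e (Ideal.mem_span_singleton_self _)
          have hQn : Q ^ (m + 2) ≤ Q ^ 2 := Ideal.pow_le_pow_right (by omega)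
          have hFA : dehomog i.succ F ∈ A := (sup_le hA1 (hQn.trans hA2)) hmem
          have hGQ2 : dehomog i.succ G ∈ Q ^ 2 := by
            refine algHom_apply_mem_of_coeff_mem _ (P ^ 2) (Q ^ 2) ?_ G hGc
            intro b hb
            rw [MvPolynomial.algebraMap_eq]
            have e : Ideal.map (MvPolynomial.C : R →+* MvPolynomial (Fin (d + 1)) R) (P ^ 2) ≤ Q ^ 2 := by
              rw [Ideal.map_pow]
              exact Ideal.pow_right_mono ((Ideal.map_mono hPM).trans hMQ) 2
            exact e (Ideal.mem_map_of_mem _ hb)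
          have hΓA : dehomog i.succ Γ₂ ∈ A := by
            have e5 : dehomog i.succ F = dehomog i.succ Γ₂ + (MvPolynomial.X 0 ^ (m + 2) +
                MvPolynomial.C v * dehomog i.succ Ψt + MvPolynomial.X 0 * dehomog i.succ H + dehomog i.succ G) := by
              rw [hsplit, hdX, hdX1]; ring
            rw [e5] at hFA
            have hrest : MvPolynomial.X 0 ^ (m + 2) + MvPolynomial.C v * dehomog i.succ Ψt +
                MvPolynomial.X 0 * dehomog i.succ H + dehomog i.succ G ∈ A := by
              refine A.add_mem (A.add_mem (A.add_mem ?_ (A.mul_mem_right _ hA4)) (A.mul_mem_right _ hA3))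
                (hA2 hGQ2)
              rw [pow_succ]
              exact A.mul_mem_left _ hA3
            have e := A.sub_mem hFA hrest
            rwa [add_sub_cancel_right] at e
          -- `dehomog_j Γ₂ ≡ u_j · dehomog_j Γ (mod chartRel)`
          set T : MvPolynomial (Fin (d + 1)) R := dehomog i.succ (MvPolynomial.rename Fin.succ Γ) with hT
          have hgen : ∀ i' : Fin (d + 1), MvPolynomial.C (c i') - MvPolynomial.C (c i.succ) *
              dehomog i.succ (MvPolynomial.X i') ∈ chartRel c i.succ :=
            fun i' => Ideal.subset_span ⟨i', rfl⟩
          have hTsplit : T = ∑ k : Fin d, dehomog i.succ (MvPolynomial.X k.succ) *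
              dehomog i.succ (MvPolynomial.rename Fin.succ (γ k)) := by
            simp only [hT, hΓ, map_sum, map_mul, MvPolynomial.rename_X, dehomog]
          have hdiff : dehomog i.succ Γ₂ - MvPolynomial.C (c i.succ) * T ∈ chartRel c i.succ := by
            rw [hsplitΓ, hTsplit, Finset.mul_sum, ← Finset.sum_sub_distrib]
            refine Ideal.sum_mem _ ?_
            intro k _
            have e : MvPolynomial.C (c k.succ) * dehomog i.succ (MvPolynomial.rename Fin.succ (γ k)) -
                MvPolynomial.C (c i.succ) * (dehomog i.succ (MvPolynomial.X k.succ) *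
                  dehomog i.succ (MvPolynomial.rename Fin.succ (γ k))) =
                (MvPolynomial.C (c k.succ) - MvPolynomial.C (c i.succ) * dehomog i.succ (MvPolynomial.X k.succ)) *
                  dehomog i.succ (MvPolynomial.rename Fin.succ (γ k)) := by ring
            rw [e]
            exact Ideal.mul_mem_right _ _ (hgen k.succ)
          have hcT : MvPolynomial.C (c i.succ) * T ∈ A := by
            have e := A.sub_mem hΓA (hA1 hdiff)
            rwa [sub_sub_cancel] at e
          have hTQ : T ∈ Q := hreg i Q hQ hMQ hXj hX0 T hcT
          have hTN : ψ T ∈ N := (hmemN T).2 hTQ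
          rw [hT, key] at hTN
          exact hTN
      · -- `X 0` is a unit mod `Q`
        have : (MvPolynomial.X 0 : MvPolynomial (Fin (d + 1)) R) ^ (m + 2) ∈ Q := by
          have e5 : dehomog i.succ F = MvPolynomial.X 0 ^ (m + 2) + (MvPolynomial.C v * dehomog i.succ Ψt +
              dehomog i.succ Γ₂ + MvPolynomial.X 0 * dehomog i.succ H + dehomog i.succ G) := by
            rw [hsplit, hdX, hdX1]; ring
          rw [e5] at hFQ
          have hrest : MvPolynomial.C v * dehomog i.succ Ψt + dehomog i.succ Γ₂ +
              MvPolynomial.X 0 * dehomog i.succ H + dehomog i.succ G ∈ Q := by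
            refine Q.add_mem (Q.add_mem (Q.add_mem hΨtQ hΓ₂Q) ?_) hGQ
            exact Q.mul_mem_left _ hHQ
          have e := Q.sub_mem hFQ hrest
          rwa [add_sub_cancel_right] at e
        exact hX0 (hQ.isPrime.mem_of_pow_mem (m + 2) this)

end JetKernels

end Summit.ResolutionOfSingularities.ResolutionOfSingularities.Theorems.JetCut
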